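import Literature.NumberTheory.GelbartRogawski1991.DoubledUnitaryGlobalSplittingData
import Literature.NumberTheory.Weil1964.ArchPhaseMapLagrangianBlock
import Literature.NumberTheory.Weil1964.ArchPhaseMapSymplectic
import Literature.NumberTheory.Weil1964.ArchSectionThetaMajorants
import Literature.NumberTheory.Weil1964.ArchCovariantSchur
import Literature.NumberTheory.Weil1964.AdelicThetaWitness
import HarnessLib

-- buildfix G11b-3 recipe (LEDGER B13-1/B13-3): elaborate sequentially so the trailing `attribute [implicit_reducible]`
-- block (reducibilityCoreExt is keyed to the async environment branch) is in force at `.olean` export.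
set_option Elab.async false

/-!
# The doubled Weil representation, archimedean half (I): the element `δ` carries the diagonal Lagrangian onto `𝕐`,
# and the `𝕐`-block of `δ ι^𝔻(p) δ⁻¹` at `∞` for `p` in the Siegel parabolic `P_Δ`
([GelbartRogawski1991, §3.1 Prop. 3.1.1 p. 455]: archimedean places of the kernel construction of the compatible
splitting; [Kudla1994, §3]: `P_Δ = M N`, the Levi acts on `Δ` through `a`; [Folland1989, §4.2 (4.24)]: the real
polarisation `(x, ξ)` of `𝓢`)

Topic `NumberTheory/GelbartRogawski1991`; namespace `Literature.NumberTheory.GelbartRogawski1991.GRConstruction`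
(the vocabulary of `DoubledUnitaryGlobalSplittingData`: `gramR`, `gramD`, `gramDA`, `hermD`, `HA`, `blk`, `IsSiegelDelta`,
`deltaBlock`, `toSpD`, `projD`, `deltaD`, `rDelta`).  KERNEL only: proved theorems; no definition, no named fact, no `sorry`.

Setting: the doubled hermitian space `𝔻 = 𝕍 ⊕ (−𝕍)` of the CM splitting datum (`T^𝔻 = e₂ (T ⊕ −T) e₂`, `T = gramR`,
`H(𝔸) = U(J^𝔻)(𝔸_{L⁺})`), its symplectic module `𝕎^𝔻_𝔸 = 𝔸^{n+n} × 𝔸^{n+n}` (`polar (adelicForm T^𝔻 ⊗ 1)`), the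
rational symplectic element `δ = deltaD` (`DoublingDiagonalPolarisation.deltaDiagMatrix` re-enumerated by `e₂ ⊕ e₂`) with
`r_F^𝔻(δ) = rDelta`, and the archimedean coordinates `archVec ∕ piArch ∕ archAct ∕ archFolland ∕ archPhaseMap ∕ freqFrame`
of the `Weil1964` files in an arbitrary real frame `eW : (L⁺ ⊗ ℝ)^{n+n} ≃L[ℝ] ℝ^σ`.  A *diagonal pair* is
`((a, a), (z, z))` re-enumerated by `e₂` — the `X ∕ Y` coordinates of a vector of the diagonal `Δ ⊂ 𝔻`.

* §1 block bookkeeping (`Sum.elim` under `e₂ ⊕ e₂`, `mulVec` in a re-enumeration, `det T` a unit, the matrix of `δ`);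
* §2 **`conj_deltaD_toSpD_apply_zero_fst`** — for `p ∈ P_Δ(𝔸)` the conjugate `δ ι^𝔻(p) δ⁻¹` preserves the Lagrangian
  `𝕐 = 0 × 𝔸^{n+n}`: `δ` maps the diagonal pair `((a,a),(z,z))` to `(0, (T^𝔻)⁻¹(T z, −a))` (`ratSp_deltaD_apply_diag`), every
  `(0, y)` is such an image (`exists_ratSp_deltaD_apply_diag_eq`), and `ι^𝔻(p)` maps diagonal pairs to diagonal pairs
  (`toSpD_apply_diag`, through `δ_Δ(p) = deltaBlock p` in the quadratic coordinates `X = x + y δ`);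
* §3 the same at `∞` in a real frame `eW`: a frame `ψ` of `𝕐_∞` by diagonal archimedean pairs (`exists_yFrame_diag`), and
  **`det_yBlock_eq_det`** — if the archimedean action of `q ∈ Sp(𝕎^𝔻_𝔸)` maps diagonal pairs to diagonal pairs through
  a real-linear `A`, then the `𝕐`-block `d` of `δ q δ⁻¹` in the frame `eW` is `ψ A ψ⁻¹`, so `det d = det A`.

This is the Lagrangian bookkeeping behind the parabolic normalisation `χ(det_Δ p)|det_Δ p|^{1/2}` of the archimedean half
of the doubled Weil representation (sequel `DoubledWeilRepresentationArchHalf`); written for the stage-1 cell `pub-hodgecm`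
(seat GR-3).  Nothing here is a claim of the manuscripts adjudicated by that cell.

## References

* S. Gelbart, J. Rogawski, *L-functions and Fourier–Jacobi coefficients for the unitary group U(3)*, Invent. Math. 105
  (1991), §3.1 Prop. 3.1.1 p. 455 [GelbartRogawski1991].
* S. S. Kudla, *Splitting metaplectic covers of dual reductive pairs*, Israel J. Math. 87 (1994) 361–401, §3
  [Kudla1994].
* M. Harris, S. S. Kudla, W. J. Sweet, *Theta dichotomy for unitary groups*, J. Amer. Math. Soc. 9 (1996), §1
  (1.11)–(1.15) (the doubled space `𝕍 ⊕ −𝕍`, `Δ`, `P_Δ`) [HarrisKudlaSweet1996].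
* G. B. Folland, *Harmonic Analysis in Phase Space*, Princeton UP 1989, §4.2 (4.24) [Folland1989].
-/

set_option autoImplicit false

noncomputable section

open scoped Classical
open scoped Matrix Kronecker TensorProduct
open NumberField IsDedekindDomain
open Literature.RepresentationTheory.HeisenbergGroup
open Literature.NumberTheory.Automorphic
open Literature.NumberTheory.Weil1964
open Literature.RepresentationTheory.HarrisKudlaSweet1996
open Literature.NumberTheory.GaloisRepresentations

namespace Literature.NumberTheory.GelbartRogawski1991.GRConstruction

open UnitaryDualPair

variable (L : Type) [Field L] [NumberField L] [IsCMField L]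
variable {N M n : ℕ} (e : Fin N × Fin M ≃ Fin n)
  (dV : Fin N → L) (hdV : ∀ i, IsCMField.complexConj L (dV i) = dV i) (hdV0 : ∀ i, dV i ≠ 0)
  (dW : Fin M → L) (hdW : ∀ i, IsCMField.complexConj L (dW i) = dW i) (hdW0 : ∀ i, dW i ≠ 0)

/-! ## §1 Block bookkeeping -/

section Bookkeeping
omit [Field L] [NumberField L] [IsCMField L] in
/-- `Sum.elim f g ∘ (e₂ ⊕ e₂)⁻¹ = Sum.elim (f ∘ e₂⁻¹) (g ∘ e₂⁻¹)`. [cite: HarrisKudlaSweet1996, §1 (1.11)–(1.15)] -/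
theorem sumElim_comp_sumCongr_e₂_symm' {K : Type*} (f g : Fin n ⊕ Fin n → K) :
    Sum.elim f g ∘ ⇑((e₂ (n := n)).sumCongr (e₂ (n := n))).symm =
      Sum.elim (f ∘ ⇑(e₂ (n := n)).symm) (g ∘ ⇑(e₂ (n := n)).symm) := by
  funext x; rcases x with x | x <;> rfl

omit [Field L] [NumberField L] [IsCMField L] in
/-- `A (v ∘ E⁻¹) = (A^{E} v) ∘ E⁻¹`: matrix action in a re-enumeration. [cite: HarrisKudlaSweet1996, §1 (1.11)–(1.15)] -/
theorem mulVec_comp_equiv_symm' {K ι κ : Type*} [Fintype ι] [Fintype κ] [DecidableEq ι] [DecidableEq κ] [CommRing K]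
    (E : ι ≃ κ) (A : Matrix κ κ K) (v : ι → K) :
    A *ᵥ (v ∘ ⇑E.symm) = (Matrix.reindex E.symm E.symm A *ᵥ v) ∘ ⇑E.symm := by
  rw [Matrix.reindex_apply, Equiv.symm_symm, Matrix.submatrix_mulVec_equiv]
  funext j
  simp only [Function.comp_apply, Equiv.apply_symm_apply]

include hdV0 hdW0 in
/-- `det T` (the undoubled real Gram matrix) is a unit. [cite: GelbartRogawski1991, §3.1 Prop. 3.1.1 p. 455] -/
theorem isUnit_det_gramR₀ : IsUnit (gramR L e dV hdV dW hdW).det := by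
  unfold gramR
  exact isUnit_det_gram (Fp L) e (isUnit_det_realDiagonal L dV hdV hdV0) (isUnit_det_realDiagonal L dW hdW hdW0)

omit [NumberField L] [IsCMField L] in
/-- the matrix of `δ`. [cite: Kudla1994, §3] -/
theorem coe_deltaD' : ((deltaD L : Matrix.symplecticGroup (Fin (n + n)) (Fp L)) :
    Matrix (Fin (n + n) ⊕ Fin (n + n)) (Fin (n + n) ⊕ Fin (n + n)) (Fp L)) =
      Matrix.reindex ((e₂ (n := n)).sumCongr (e₂ (n := n))) ((e₂ (n := n)).sumCongr (e₂ (n := n)))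
        (deltaDiagMatrix (Fp L) (Fin n)) := rfl

include hdV0 hdW0 in
/-- the archimedean part of `T^𝔻 ⊗ 1` is invertible. [cite: GelbartRogawski1991, §3.1 Prop. 3.1.1 p. 455] -/
theorem isUnit_archMat_gramDA : IsUnit (archMat (Fp L) (Fin (n + n)) (gramDA L e dV hdV dW hdW)) :=
  isUnit_archMat_of_isUnit _
    ((Matrix.isUnit_iff_isUnit_det _).2 (isUnit_det_gramDA L e dV hdV hdV0 dW hdW hdW0))

end Bookkeeping

/-! ## §2 `δ ι^𝔻(p) δ⁻¹` preserves the Lagrangian `𝕐` for `p ∈ P_Δ(𝔸)` -/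

section SiegelLagrangian

open Literature.RepresentationTheory.HeisenbergGroup.SymplecticMatrix

/-- `T^𝔻 ⊗ 1 = reindex e₂ e₂ ((T ⊗ 1) ⊕ (−T ⊗ 1))`. [cite: HarrisKudlaSweet1996, §1 (1.11)–(1.15)] -/
theorem gramDA_eq_reindex : gramDA L e dV hdV dW hdW =
    Matrix.reindex (e₂ (n := n)) (e₂ (n := n)) (Matrix.fromBlocks (((gramR L e dV hdV dW hdW).map (algebraMap (Fp L) (AdeleRing (𝓞 (Fp L)) (Fp L))))) 0 0 (-((gramR L e dV hdV dW hdW).map (algebraMap (Fp L) (AdeleRing (𝓞 (Fp L)) (Fp L)))))) := by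
  unfold gramDA gramD
  rw [Matrix.reindex_apply, Matrix.reindex_apply, ← Matrix.submatrix_map, Matrix.fromBlocks_map, Matrix.map_zero _ (map_zero _),
    Matrix.map_neg _ (map_neg _)]

/-- `(T^𝔻 ⊗ 1) (z, z) = (T z, −T z)` in the block enumeration. [cite: HarrisKudlaSweet1996, §1 (1.11)–(1.15)] -/
theorem gramDA_mulVec_diag (z : Fin n → AdeleRing (𝓞 (Fp L)) (Fp L)) :
    gramDA L e dV hdV dW hdW *ᵥ (Sum.elim z z ∘ ⇑(e₂ (n := n)).symm) =
      Sum.elim (((gramR L e dV hdV dW hdW).map (algebraMap (Fp L) (AdeleRing (𝓞 (Fp L)) (Fp L)))) *ᵥ z) (-(((gramR L e dV hdV dW hdW).map (algebraMap (Fp L) (AdeleRing (𝓞 (Fp L)) (Fp L)))) *ᵥ z)) ∘ ⇑(e₂ (n := n)).symm := by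
  have h1 : Matrix.reindex (e₂ (n := n)).symm (e₂ (n := n)).symm (gramDA L e dV hdV dW hdW) =
      Matrix.fromBlocks (((gramR L e dV hdV dW hdW).map (algebraMap (Fp L) (AdeleRing (𝓞 (Fp L)) (Fp L))))) 0 0 (-((gramR L e dV hdV dW hdW).map (algebraMap (Fp L) (AdeleRing (𝓞 (Fp L)) (Fp L))))) := by
    rw [gramDA_eq_reindex]; exact (Matrix.reindex (e₂ (n := n)) (e₂ (n := n))).symm_apply_apply _
  rw [mulVec_comp_equiv_symm', h1, Matrix.fromBlocks_mulVec, Sum.elim_comp_inl, Sum.elim_comp_inr, Matrix.zero_mulVec,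
    Matrix.neg_mulVec, add_zero, zero_add]

omit [IsCMField L] in
/-- the matrix of `δ` read in `𝔸_{L⁺}`. [cite: Kudla1994, §3] -/
theorem coe_mapHom_deltaD :
    ((mapHom (algebraMap (Fp L) (AdeleRing (𝓞 (Fp L)) (Fp L))) (deltaD L) : Matrix.symplecticGroup (Fin (n + n)) _) :
        Matrix (Fin (n + n) ⊕ Fin (n + n)) (Fin (n + n) ⊕ Fin (n + n)) (AdeleRing (𝓞 (Fp L)) (Fp L))) =
      Matrix.reindex ((e₂ (n := n)).sumCongr (e₂ (n := n))) ((e₂ (n := n)).sumCongr (e₂ (n := n)))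
        (deltaDiagMatrix (AdeleRing (𝓞 (Fp L)) (Fp L)) (Fin n)) := by
  rw [coe_mapHom, coe_deltaD', Matrix.reindex_apply, Matrix.reindex_apply, ← Matrix.submatrix_map, deltaDiagMatrix_map]

/-- **`δ_𝔸` maps a Darboux-diagonal vector to `𝕐`**: `δ (P (a,a; z,z)) = (0; (T z, −a))` (adelic twin of `deltaD_mulVec_diag`). [cite: Kudla1994, §3] -/
theorem mapHom_deltaD_mulVec_diag (a z : Fin n → AdeleRing (𝓞 (Fp L)) (Fp L)) :
    ((mapHom (algebraMap (Fp L) (AdeleRing (𝓞 (Fp L)) (Fp L))) (deltaD L) : Matrix.symplecticGroup (Fin (n + n)) _) :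
        Matrix (Fin (n + n) ⊕ Fin (n + n)) (Fin (n + n) ⊕ Fin (n + n)) (AdeleRing (𝓞 (Fp L)) (Fp L))) *ᵥ
        Sum.elim (Sum.elim a a ∘ ⇑(e₂ (n := n)).symm) (gramDA L e dV hdV dW hdW *ᵥ (Sum.elim z z ∘ ⇑(e₂ (n := n)).symm)) =
      Sum.elim (0 : Fin (n + n) → _) (Sum.elim (((gramR L e dV hdV dW hdW).map (algebraMap (Fp L) (AdeleRing (𝓞 (Fp L)) (Fp L)))) *ᵥ z) (-a) ∘ ⇑(e₂ (n := n)).symm) := by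
  have h1 : Matrix.reindex ((e₂ (n := n)).sumCongr (e₂ (n := n))).symm ((e₂ (n := n)).sumCongr (e₂ (n := n))).symm
      ((mapHom (algebraMap (Fp L) (AdeleRing (𝓞 (Fp L)) (Fp L))) (deltaD L) : Matrix.symplecticGroup (Fin (n + n)) _) :
        Matrix (Fin (n + n) ⊕ Fin (n + n)) (Fin (n + n) ⊕ Fin (n + n)) (AdeleRing (𝓞 (Fp L)) (Fp L))) =
      deltaDiagMatrix (AdeleRing (𝓞 (Fp L)) (Fp L)) (Fin n) := by
    rw [coe_mapHom_deltaD]; exact (Matrix.reindex _ _).symm_apply_apply _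
  rw [gramDA_mulVec_diag, ← sumElim_comp_sumCongr_e₂_symm', mulVec_comp_equiv_symm', h1, deltaDiagMatrix_mulVec_diag,
    sumElim_comp_sumCongr_e₂_symm']
  rfl

include hdV0 hdW0 in
/-- `π(r_F^𝔻(δ)) = δ` (the tree's `ratSp` transport of `deltaD` to `Sp(𝕎^𝔻_𝔸)`).
[cite: GelbartRogawski1991, §3.1 Prop. 3.1.1 p. 455] -/
theorem projD_rDelta : projD L e dV hdV dW hdW (rDelta L e dV hdV hdV0 dW hdW hdW0) =
    ratSp (Fp L) (gramDA L e dV hdV dW hdW) (isUnit_det_gramDA L e dV hdV hdV0 dW hdW hdW0) (deltaD L) :=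
  proj_ratThetaLiftCont (Fp L) (gramDA L e dV hdV dW hdW) (isUnit_det_gramDA L e dV hdV hdV0 dW hdW hdW0) (deltaD L)

/-- **`δ` in `Sp(𝕎^𝔻_𝔸)` carries a diagonal pair to `𝕐`**: `δ (a,a; z,z) = (0, (T^𝔻)⁻¹(T z, −a))`. [cite: Kudla1994, §3] -/
theorem ratSp_deltaD_apply_diag (a z : Fin n → AdeleRing (𝓞 (Fp L)) (Fp L)) :
    ((ratSp (Fp L) (gramDA L e dV hdV dW hdW) (isUnit_det_gramDA L e dV hdV hdV0 dW hdW hdW0) (deltaD L)).1 : _ ≃ₗ[AdeleRing (𝓞 (Fp L)) (Fp L)] _)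
        (Sum.elim a a ∘ ⇑(e₂ (n := n)).symm, Sum.elim z z ∘ ⇑(e₂ (n := n)).symm) =
      (0, (gramDA L e dV hdV dW hdW)⁻¹ *ᵥ (Sum.elim (((gramR L e dV hdV dW hdW).map (algebraMap (Fp L) (AdeleRing (𝓞 (Fp L)) (Fp L)))) *ᵥ z) (-a) ∘ ⇑(e₂ (n := n)).symm)) := by
  show ((transportSp (gramDA L e dV hdV dW hdW) (isUnit_det_gramDA L e dV hdV hdV0 dW hdW hdW0)
    (mapHom (algebraMap (Fp L) (AdeleRing (𝓞 (Fp L)) (Fp L))) (deltaD L)) : symplecticGroup _).1 :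
      _ ≃ₗ[AdeleRing (𝓞 (Fp L)) (Fp L)] _) _ = _
  rw [coe_transportSp_apply, darboux_apply, mapHom_deltaD_mulVec_diag, darboux_symm_sumElim]

include hdV0 hdW0 in
/-- every `(0, y) ∈ 𝕐(𝔸)` is the `δ`-image of a diagonal pair. [cite: Kudla1994, §3] -/
theorem exists_ratSp_deltaD_apply_diag_eq (y : Fin (n + n) → AdeleRing (𝓞 (Fp L)) (Fp L)) :
    ∃ a z : Fin n → AdeleRing (𝓞 (Fp L)) (Fp L),
      ((ratSp (Fp L) (gramDA L e dV hdV dW hdW) (isUnit_det_gramDA L e dV hdV hdV0 dW hdW hdW0) (deltaD L)).1 : _ ≃ₗ[AdeleRing (𝓞 (Fp L)) (Fp L)] _)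
          (Sum.elim a a ∘ ⇑(e₂ (n := n)).symm, Sum.elim z z ∘ ⇑(e₂ (n := n)).symm) = (0, y) := by
  have hR : IsUnit (((gramR L e dV hdV dW hdW).map (algebraMap (Fp L) (AdeleRing (𝓞 (Fp L)) (Fp L))))).det := by
    rw [← RingHom.mapMatrix_apply, ← RingHom.map_det]
    exact (isUnit_det_gramR₀ L e dV hdV hdV0 dW hdW hdW0).map _
  set y' := gramDA L e dV hdV dW hdW *ᵥ y with hy'
  refine ⟨-(y' ∘ ⇑(e₂ (n := n)) ∘ Sum.inr), (((gramR L e dV hdV dW hdW).map (algebraMap (Fp L) (AdeleRing (𝓞 (Fp L)) (Fp L)))))⁻¹ *ᵥ (y' ∘ ⇑(e₂ (n := n)) ∘ Sum.inl), ?_⟩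
  rw [ratSp_deltaD_apply_diag L e dV hdV hdV0 dW hdW hdW0, Matrix.mulVec_mulVec, Matrix.mul_nonsing_inv _ hR, Matrix.one_mulVec, neg_neg]
  refine Prod.ext rfl ?_
  have h2 : Sum.elim (y' ∘ ⇑(e₂ (n := n)) ∘ Sum.inl) (y' ∘ ⇑(e₂ (n := n)) ∘ Sum.inr) ∘ ⇑(e₂ (n := n)).symm = y' := by
    funext j
    obtain ⟨k, rfl⟩ := (e₂ (n := n)).surjective j
    simp only [Function.comp_apply, Equiv.symm_apply_apply]
    rcases k with k | k <;> rfl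
  show (gramDA L e dV hdV dW hdW)⁻¹ *ᵥ _ = y
  rw [h2, hy', Matrix.mulVec_mulVec, Matrix.nonsing_inv_mul _ (isUnit_det_gramDA L e dV hdV hdV0 dW hdW hdW0), Matrix.one_mulVec]

/-- `reIm` of a diagonal vector is a pair of diagonal vectors (generic twin of `reIm_diag`). [cite: HarrisKudlaSweet1996, §1 (1.11)–(1.15)] -/
theorem reIm_diag' {R S : Type*} [CommRing R] [CommRing S] (Ψ : (R × R) ≃+ S) (W : Fin n → S) :
    UnitaryGroup.QuadraticCoordinates.reIm Ψ (Fin (n + n)) (Sum.elim W W ∘ ⇑(e₂ (n := n)).symm) =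
      (Sum.elim (fun i => UnitaryGroup.QuadraticCoordinates.re Ψ (W i))
          (fun i => UnitaryGroup.QuadraticCoordinates.re Ψ (W i)) ∘ ⇑(e₂ (n := n)).symm,
        Sum.elim (fun i => UnitaryGroup.QuadraticCoordinates.im Ψ (W i))
          (fun i => UnitaryGroup.QuadraticCoordinates.im Ψ (W i)) ∘ ⇑(e₂ (n := n)).symm) := by
  refine Prod.ext (funext fun j => ?_) (funext fun j => ?_)
  · rw [UnitaryGroup.QuadraticCoordinates.reIm_apply_fst]
    simp only [Function.comp_apply]
    generalize (e₂ (n := n)).symm j = k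
    rcases k with k | k <;> rfl
  · rw [UnitaryGroup.QuadraticCoordinates.reIm_apply_snd]
    simp only [Function.comp_apply]
    generalize (e₂ (n := n)).symm j = k
    rcases k with k | k <;> rfl

/-- `reIm⁻¹` of a pair of diagonal vectors is diagonal (generic twin of `reIm_symm_diag`). [cite: HarrisKudlaSweet1996, §1 (1.11)–(1.15)] -/
theorem reIm_symm_diag' {R S : Type*} [CommRing R] [CommRing S] (Ψ : (R × R) ≃+ S) (a z : Fin n → R) :
    (UnitaryGroup.QuadraticCoordinates.reIm Ψ (Fin (n + n))).symm
        (Sum.elim a a ∘ ⇑(e₂ (n := n)).symm, Sum.elim z z ∘ ⇑(e₂ (n := n)).symm) =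
      Sum.elim (fun i => Ψ (a i, z i)) (fun i => Ψ (a i, z i)) ∘ ⇑(e₂ (n := n)).symm := by
  funext j
  rw [UnitaryGroup.QuadraticCoordinates.reIm_symm_apply]
  simp only [Function.comp_apply]
  generalize (e₂ (n := n)).symm j = k
  rcases k with k | k <;> rfl

/-- a Siegel `p ∈ P_Δ(𝔸)` maps diagonal vectors `(W, W)` to `(δ_Δ(p) W, δ_Δ(p) W)`. [cite: Kudla1994, §3] -/
theorem mulVec_diag_of_isSiegelDelta (p : HA L e dV hdV dW hdW) (hS : IsSiegelDelta L e dV hdV dW hdW p)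
    (W : Fin n → AdeleRing (𝓞 L) L) :
    ((p : GL (Fin (n + n)) (AdeleRing (𝓞 L) L)) : Matrix (Fin (n + n)) (Fin (n + n)) (AdeleRing (𝓞 L) L)) *ᵥ
        (Sum.elim W W ∘ ⇑(e₂ (n := n)).symm) =
      Sum.elim (deltaBlock L e dV hdV dW hdW p *ᵥ W) (deltaBlock L e dV hdV dW hdW p *ᵥ W) ∘ ⇑(e₂ (n := n)).symm := by
  rw [mulVec_comp_equiv_symm']
  have h1 : blk L e dV hdV dW hdW p *ᵥ Sum.elim W W =
      Sum.elim (((blk L e dV hdV dW hdW p).toBlocks₁₁ + (blk L e dV hdV dW hdW p).toBlocks₁₂) *ᵥ W)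
        (((blk L e dV hdV dW hdW p).toBlocks₂₁ + (blk L e dV hdV dW hdW p).toBlocks₂₂) *ᵥ W) := by
    conv_lhs => rw [← Matrix.fromBlocks_toBlocks (blk L e dV hdV dW hdW p)]
    rw [Matrix.fromBlocks_mulVec, Sum.elim_comp_inl, Sum.elim_comp_inr, Matrix.add_mulVec, Matrix.add_mulVec]
  have hS' : (blk L e dV hdV dW hdW p).toBlocks₁₁ + (blk L e dV hdV dW hdW p).toBlocks₁₂ =
      (blk L e dV hdV dW hdW p).toBlocks₂₁ + (blk L e dV hdV dW hdW p).toBlocks₂₂ := hS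
  rw [show Matrix.reindex (e₂ (n := n)).symm (e₂ (n := n)).symm
      ((p : GL (Fin (n + n)) (AdeleRing (𝓞 L) L)) : Matrix (Fin (n + n)) (Fin (n + n)) (AdeleRing (𝓞 L) L)) =
      blk L e dV hdV dW hdW p from rfl, h1]
  unfold deltaBlock
  rw [hS']

/-- **`ι^𝔻(p)` of a Siegel `p` maps a diagonal pair to the diagonal pair of `δ_Δ(p)`-transformed coordinates.** [cite: Kudla1994, §3] -/
theorem toSpD_apply_diag (p : HA L e dV hdV dW hdW) (hS : IsSiegelDelta L e dV hdV dW hdW p)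
    (a z : Fin n → AdeleRing (𝓞 (Fp L)) (Fp L)) :
    ((toSpD L e dV hdV dW hdW p).1 : _ ≃ₗ[AdeleRing (𝓞 (Fp L)) (Fp L)] _)
        (Sum.elim a a ∘ ⇑(e₂ (n := n)).symm, Sum.elim z z ∘ ⇑(e₂ (n := n)).symm) =
      (Sum.elim (fun i => UnitaryGroup.QuadraticCoordinates.re (UnitaryGroup.quadraticAdeleEquiv (Fp L) L (IsCMField.complexConj L) (complexConj_imagUnit L) (imagUnit_ne_zero L)).toAddEquiv ((deltaBlock L e dV hdV dW hdW p *ᵥ fun i => (UnitaryGroup.quadraticAdeleEquiv (Fp L) L (IsCMField.complexConj L) (complexConj_imagUnit L) (imagUnit_ne_zero L)).toAddEquiv (a i, z i)) i))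
          (fun i => UnitaryGroup.QuadraticCoordinates.re (UnitaryGroup.quadraticAdeleEquiv (Fp L) L (IsCMField.complexConj L) (complexConj_imagUnit L) (imagUnit_ne_zero L)).toAddEquiv ((deltaBlock L e dV hdV dW hdW p *ᵥ fun i => (UnitaryGroup.quadraticAdeleEquiv (Fp L) L (IsCMField.complexConj L) (complexConj_imagUnit L) (imagUnit_ne_zero L)).toAddEquiv (a i, z i)) i)) ∘
          ⇑(e₂ (n := n)).symm,
        Sum.elim (fun i => UnitaryGroup.QuadraticCoordinates.im (UnitaryGroup.quadraticAdeleEquiv (Fp L) L (IsCMField.complexConj L) (complexConj_imagUnit L) (imagUnit_ne_zero L)).toAddEquiv ((deltaBlock L e dV hdV dW hdW p *ᵥ fun i => (UnitaryGroup.quadraticAdeleEquiv (Fp L) L (IsCMField.complexConj L) (complexConj_imagUnit L) (imagUnit_ne_zero L)).toAddEquiv (a i, z i)) i))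
          (fun i => UnitaryGroup.QuadraticCoordinates.im (UnitaryGroup.quadraticAdeleEquiv (Fp L) L (IsCMField.complexConj L) (complexConj_imagUnit L) (imagUnit_ne_zero L)).toAddEquiv ((deltaBlock L e dV hdV dW hdW p *ᵥ fun i => (UnitaryGroup.quadraticAdeleEquiv (Fp L) L (IsCMField.complexConj L) (complexConj_imagUnit L) (imagUnit_ne_zero L)).toAddEquiv (a i, z i)) i)) ∘
          ⇑(e₂ (n := n)).symm) := by
  have h1 : (Sum.elim a a ∘ ⇑(e₂ (n := n)).symm, Sum.elim z z ∘ ⇑(e₂ (n := n)).symm) =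
      UnitaryGroup.QuadraticCoordinates.reIm (UnitaryGroup.quadraticAdeleEquiv (Fp L) L (IsCMField.complexConj L) (complexConj_imagUnit L) (imagUnit_ne_zero L)).toAddEquiv (Fin (n + n))
        (Sum.elim (fun i => (UnitaryGroup.quadraticAdeleEquiv (Fp L) L (IsCMField.complexConj L) (complexConj_imagUnit L) (imagUnit_ne_zero L)).toAddEquiv (a i, z i)) (fun i => (UnitaryGroup.quadraticAdeleEquiv (Fp L) L (IsCMField.complexConj L) (complexConj_imagUnit L) (imagUnit_ne_zero L)).toAddEquiv (a i, z i)) ∘ ⇑(e₂ (n := n)).symm) := by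
    rw [← reIm_symm_diag' (UnitaryGroup.quadraticAdeleEquiv (Fp L) L (IsCMField.complexConj L) (complexConj_imagUnit L) (imagUnit_ne_zero L)).toAddEquiv a z, AddEquiv.apply_symm_apply]
  rw [h1]
  show ((UnitaryGroup.adelicToSymplectic (Fp L) L (IsCMField.complexConj L) (n + n) (complexConj_imagUnit L)
    (imagUnit_ne_zero L) (imagUnit_mul_self L) (gramD_isSymm L e dV hdV dW hdW) rfl p).1 : _ ≃ₗ[AdeleRing (𝓞 (Fp L)) (Fp L)] _)
      (UnitaryGroup.QuadraticCoordinates.reIm (UnitaryGroup.quadraticAdeleEquiv (Fp L) L (IsCMField.complexConj L) (complexConj_imagUnit L) (imagUnit_ne_zero L)).toAddEquiv (Fin (n + n)) _) = _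
  rw [UnitaryGroup.adelicToSymplectic_reIm, mulVec_diag_of_isSiegelDelta L e dV hdV dW hdW p hS, reIm_diag']

include hdV0 hdW0 in
/-- **U1a: `δ ι^𝔻(p) δ⁻¹ ∈ P_𝕐(𝔸)` for `p ∈ P_Δ(𝔸)`** — it preserves the Lagrangian `𝕐 = 0 × 𝔸^{n+n}`. [cite: Kudla1994, §3] -/
theorem conj_deltaD_toSpD_apply_zero_fst (p : HA L e dV hdV dW hdW) (hS : IsSiegelDelta L e dV hdV dW hdW p)
    (y : Fin (n + n) → AdeleRing (𝓞 (Fp L)) (Fp L)) :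
    (((ratSp (Fp L) (gramDA L e dV hdV dW hdW) (isUnit_det_gramDA L e dV hdV hdV0 dW hdW hdW0) (deltaD L) * toSpD L e dV hdV dW hdW p * (ratSp (Fp L) (gramDA L e dV hdV dW hdW) (isUnit_det_gramDA L e dV hdV hdV0 dW hdW hdW0) (deltaD L))⁻¹).1 :
        _ ≃ₗ[AdeleRing (𝓞 (Fp L)) (Fp L)] _) (0, y)).1 = 0 := by
  obtain ⟨a, z, haz⟩ := exists_ratSp_deltaD_apply_diag_eq L e dV hdV hdV0 dW hdW hdW0 y
  have hinv : (((ratSp (Fp L) (gramDA L e dV hdV dW hdW) (isUnit_det_gramDA L e dV hdV hdV0 dW hdW hdW0) (deltaD L))⁻¹).1 : _ ≃ₗ[AdeleRing (𝓞 (Fp L)) (Fp L)] _) (0, y) =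
      (Sum.elim a a ∘ ⇑(e₂ (n := n)).symm, Sum.elim z z ∘ ⇑(e₂ (n := n)).symm) := by
    rw [← haz]
    exact ((ratSp (Fp L) (gramDA L e dV hdV dW hdW) (isUnit_det_gramDA L e dV hdV hdV0 dW hdW hdW0) (deltaD L)).1 : _ ≃ₗ[AdeleRing (𝓞 (Fp L)) (Fp L)] _).symm_apply_apply _
  show (((ratSp (Fp L) (gramDA L e dV hdV dW hdW) (isUnit_det_gramDA L e dV hdV hdV0 dW hdW hdW0) (deltaD L)).1 : _ ≃ₗ[AdeleRing (𝓞 (Fp L)) (Fp L)] _)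
    (((toSpD L e dV hdV dW hdW p).1 : _ ≃ₗ[AdeleRing (𝓞 (Fp L)) (Fp L)] _)
      ((((ratSp (Fp L) (gramDA L e dV hdV dW hdW) (isUnit_det_gramDA L e dV hdV hdV0 dW hdW hdW0) (deltaD L))⁻¹).1 : _ ≃ₗ[AdeleRing (𝓞 (Fp L)) (Fp L)] _) (0, y)))).1 = 0
  rw [hinv, toSpD_apply_diag L e dV hdV dW hdW p hS, ratSp_deltaD_apply_diag L e dV hdV hdV0 dW hdW hdW0]

end SiegelLagrangian

/-! ## §3 The `𝕐`-block at `∞` on diagonal archimedean pairs, in a real frame `eW` -/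

section ArchFrame

variable {σ : Type*} [Fintype σ]
  (eW : (Fin (n + n) → mixedEmbedding.mixedSpace (Fp L)) ≃L[ℝ] (σ → ℝ))

omit [IsCMField L] hdV hdW in
/-- `archVec` of a doubled diagonal vector. [cite: Folland1989, §4.2 (4.24)] -/
theorem archVec_diag (a : Fin n → mixedEmbedding.mixedSpace (Fp L)) :
    archVec (Fp L) (Fin (n + n)) (Sum.elim a a ∘ ⇑(e₂ (n := n)).symm) =
      Sum.elim (archVec (Fp L) (Fin n) a) (archVec (Fp L) (Fin n) a) ∘ ⇑(e₂ (n := n)).symm := by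
  funext i
  refine Prod.ext ?_ ?_
  · rw [archVec_apply_fst, Function.comp_apply, Function.comp_apply]
    generalize (e₂ (n := n)).symm i = k
    cases k <;> rfl
  · rw [archVec_apply_snd, Function.comp_apply]
    generalize (e₂ (n := n)).symm i = k
    cases k <;> rfl

omit [IsCMField L] hdV hdW in
/-- `piArch` of a re-enumerated `Sum.elim`. [cite: Folland1989, §4.2 (4.24)] -/
theorem piArch_sumElim (P Q : Fin n → AdeleRing (𝓞 (Fp L)) (Fp L)) :
    piArch (Fp L) (Fin (n + n)) (Sum.elim P Q ∘ ⇑(e₂ (n := n)).symm) =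
      Sum.elim (piArch (Fp L) (Fin n) P) (piArch (Fp L) (Fin n) Q) ∘ ⇑(e₂ (n := n)).symm := by
  funext i
  rw [piArch_apply, Function.comp_apply, Function.comp_apply]
  generalize (e₂ (n := n)).symm i = k
  cases k <;> rfl

omit [IsCMField L] hdV hdW in
/-- `piArch (T Y) = T_∞ (piArch Y)` for every adelic vector `Y`. [cite: Folland1989, §4.2 (4.24)] -/
theorem piArch_mulVec {m : Type} [Fintype m] (T : Matrix m m (AdeleRing (𝓞 (Fp L)) (Fp L)))
    (Y : m → AdeleRing (𝓞 (Fp L)) (Fp L)) :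
    piArch (Fp L) m (T *ᵥ Y) = archMat (Fp L) m T *ᵥ piArch (Fp L) m Y := by
  funext i
  rw [piArch_apply, Matrix.mulVec, dotProduct, AdeleRing.fst_sum, map_sum, Matrix.mulVec, dotProduct]
  refine Finset.sum_congr rfl fun j _ => ?_
  rw [show (T i j * Y j).1 = (T i j).1 * (Y j).1 from rfl, map_mul, piArch_apply]
  rfl

omit [IsCMField L] hdV hdW in
/-- `piArch (−Y) = −piArch Y`. [cite: Folland1989, §4.2 (4.24)] -/
theorem piArch_neg' {m : Type} (Y : m → AdeleRing (𝓞 (Fp L)) (Fp L)) : piArch (Fp L) m (-Y) = -piArch (Fp L) m Y := by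
  funext i
  rw [piArch_apply, Pi.neg_apply, Pi.neg_apply, piArch_apply, show (-Y i).1 = -(Y i).1 from rfl, map_neg]

include hdV0 hdW0 in
/-- the archimedean action of `δ` on a diagonal pair:
`archAct δ (diag a, diag z) = (0, (T^𝔻 ⊗ 1)_∞⁻¹ (T_∞ z ⊕ (−a)))`. [cite: Kudla1994, §3] -/
theorem archAct_deltaD_diag (a z : Fin n → mixedEmbedding.mixedSpace (Fp L)) :
    archAct (gramDA L e dV hdV dW hdW) (ratSp (Fp L) (gramDA L e dV hdV dW hdW) (isUnit_det_gramDA L e dV hdV hdV0 dW hdW hdW0) (deltaD L))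
        (Sum.elim a a ∘ ⇑(e₂ (n := n)).symm, Sum.elim z z ∘ ⇑(e₂ (n := n)).symm) =
      (0, archMat (Fp L) (Fin (n + n)) (gramDA L e dV hdV dW hdW)⁻¹ *ᵥ
        (Sum.elim (archMat (Fp L) (Fin n) ((gramR L e dV hdV dW hdW).map (algebraMap (Fp L) (AdeleRing (𝓞 (Fp L)) (Fp L)))) *ᵥ z)
          (-a) ∘ ⇑(e₂ (n := n)).symm)) := by
  unfold archAct
  rw [archVec_diag, archVec_diag, ratSp_deltaD_apply_diag L e dV hdV hdV0 dW hdW hdW0]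
  refine Prod.ext ?_ ?_
  · show piArch (Fp L) (Fin (n + n)) 0 = 0
    exact piArch_zero (Fp L) (Fin (n + n))
  · show piArch (Fp L) (Fin (n + n)) _ = _
    rw [piArch_mulVec, piArch_sumElim, piArch_mulVec, piArch_archVec, piArch_neg', piArch_archVec]

include hdV0 hdW0 in
/-- **the frame `ψ` of `𝕐_∞` by diagonal archimedean pairs**: a real-linear equivalence `ψ : (a, z) ↦
φ((T^𝔻 ⊗ 1)_∞⁻¹ (T_∞ z ⊕ (−a)))` with `S_δ(Ξ(diag a, diag z)) = (0, ψ(a, z))` in the frame `eW` — `δ` maps the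
diagonal Lagrangian onto `𝕐` at `∞`. [cite: Folland1989, §4.2 (4.24)] -/
theorem exists_yFrame_diag :
    ∃ ψ : ((Fin n → mixedEmbedding.mixedSpace (Fp L)) × (Fin n → mixedEmbedding.mixedSpace (Fp L))) ≃ₗ[ℝ] (σ → ℝ),
      ∀ az : (Fin n → mixedEmbedding.mixedSpace (Fp L)) × (Fin n → mixedEmbedding.mixedSpace (Fp L)),
        archPhaseMap (gramDA L e dV hdV dW hdW) eW (isUnit_archMat_gramDA L e dV hdV hdV0 dW hdW hdW0)
            (ratSp (Fp L) (gramDA L e dV hdV dW hdW) (isUnit_det_gramDA L e dV hdV hdV0 dW hdW hdW0) (deltaD L))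
            (archFolland (gramDA L e dV hdV dW hdW) eW
              (Sum.elim az.1 az.1 ∘ ⇑(e₂ (n := n)).symm, Sum.elim az.2 az.2 ∘ ⇑(e₂ (n := n)).symm)) =
          (0, ψ az) := by
  have hR : IsUnit (archMat (Fp L) (Fin n) ((gramR L e dV hdV dW hdW).map (algebraMap (Fp L) (AdeleRing (𝓞 (Fp L)) (Fp L))))) := by
    refine isUnit_archMat_of_isUnit _ ((Matrix.isUnit_iff_isUnit_det _).2 ?_)
    rw [← RingHom.mapMatrix_apply, ← RingHom.map_det]
    exact (isUnit_det_gramR₀ L e dV hdV hdV0 dW hdW hdW0).map _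
  have hN : IsUnit (archMat (Fp L) (Fin (n + n)) (gramDA L e dV hdV dW hdW)⁻¹) := by
    refine isUnit_archMat_of_isUnit _ ((Matrix.isUnit_iff_isUnit_det _).2 ?_)
    exact Matrix.isUnit_nonsing_inv_det _ (isUnit_det_gramDA L e dV hdV hdV0 dW hdW hdW0)
  -- the diagonal packing `D(a, z) = (T_∞ z) ⊕ (−a)` (re-enumerated), real-linear and bijective
  obtain ⟨D, hD⟩ : ∃ D : ((Fin n → mixedEmbedding.mixedSpace (Fp L)) × (Fin n → mixedEmbedding.mixedSpace (Fp L))) →ₗ[ℝ]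
      (Fin (n + n) → mixedEmbedding.mixedSpace (Fp L)),
      ∀ az, D az = Sum.elim (archMat (Fp L) (Fin n) ((gramR L e dV hdV dW hdW).map
        (algebraMap (Fp L) (AdeleRing (𝓞 (Fp L)) (Fp L)))) *ᵥ az.2) (-az.1) ∘ ⇑(e₂ (n := n)).symm :=
    ⟨(LinearMap.funLeft ℝ (mixedEmbedding.mixedSpace (Fp L)) ⇑(e₂ (n := n)).symm :
        (Fin n ⊕ Fin n → mixedEmbedding.mixedSpace (Fp L)) →ₗ[ℝ] (Fin (n + n) → mixedEmbedding.mixedSpace (Fp L))) ∘ₗ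
      (LinearEquiv.sumArrowLequivProdArrow (Fin n) (Fin n) ℝ (mixedEmbedding.mixedSpace (Fp L))).symm.toLinearMap ∘ₗ
      (((Matrix.toLin' (archMat (Fp L) (Fin n) ((gramR L e dV hdV dW hdW).map
          (algebraMap (Fp L) (AdeleRing (𝓞 (Fp L)) (Fp L)))))).restrictScalars ℝ :
          (Fin n → mixedEmbedding.mixedSpace (Fp L)) →ₗ[ℝ] (Fin n → mixedEmbedding.mixedSpace (Fp L))).prodMap
        (-LinearMap.id : (Fin n → mixedEmbedding.mixedSpace (Fp L)) →ₗ[ℝ] (Fin n → mixedEmbedding.mixedSpace (Fp L)))) ∘ₗ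
      (LinearEquiv.prodComm ℝ (Fin n → mixedEmbedding.mixedSpace (Fp L)) (Fin n → mixedEmbedding.mixedSpace (Fp L))).toLinearMap,
      fun _ => rfl⟩
  have hDb : Function.Bijective D := by
    have hb := mulVec_bijective_of_isUnit hR
    constructor
    · intro x y h
      rw [hD, hD] at h
      have h' := congrArg (fun f => f ∘ ⇑(e₂ (n := n))) h
      simp only [Function.comp_assoc, Equiv.symm_comp_self, Function.comp_id] at h'
      have h1 := congrArg (fun f => f ∘ Sum.inl) h'
      have h2 := congrArg (fun f => f ∘ Sum.inr) h'
      simp only [Sum.elim_comp_inl, Sum.elim_comp_inr, neg_inj] at h1 h2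
      exact Prod.ext h2 (hb.1 h1)
    · intro f
      obtain ⟨z, hz⟩ := hb.2 (f ∘ ⇑(e₂ (n := n)) ∘ Sum.inl)
      refine ⟨(-(f ∘ ⇑(e₂ (n := n)) ∘ Sum.inr), z), ?_⟩
      rw [hD]
      funext x
      obtain ⟨k, rfl⟩ := (e₂ (n := n)).surjective x
      rw [Function.comp_apply, Equiv.symm_apply_apply]
      cases k with
      | inl j => exact congrFun hz j
      | inr j => simp only [Sum.elim_inr, neg_neg, Function.comp_apply]
  -- `ψ = φ ∘ (T^𝔻 ⊗ 1)_∞⁻¹ ∘ D`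
  obtain ⟨ψ, hψ⟩ : ∃ ψ : ((Fin n → mixedEmbedding.mixedSpace (Fp L)) × (Fin n → mixedEmbedding.mixedSpace (Fp L))) →ₗ[ℝ]
      (σ → ℝ), ∀ az, ψ az = freqFrame (gramDA L e dV hdV dW hdW) eW (isUnit_archMat_gramDA L e dV hdV hdV0 dW hdW hdW0)
        (archMat (Fp L) (Fin (n + n)) (gramDA L e dV hdV dW hdW)⁻¹ *ᵥ D az) :=
    ⟨(freqFrame (gramDA L e dV hdV dW hdW) eW (isUnit_archMat_gramDA L e dV hdV hdV0 dW hdW hdW0)).toLinearMap ∘ₗ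
      ((Matrix.toLin' (archMat (Fp L) (Fin (n + n)) (gramDA L e dV hdV dW hdW)⁻¹)).restrictScalars ℝ :
        (Fin (n + n) → mixedEmbedding.mixedSpace (Fp L)) →ₗ[ℝ] (Fin (n + n) → mixedEmbedding.mixedSpace (Fp L))) ∘ₗ D,
      fun _ => rfl⟩
  have hψb : Function.Bijective ψ := by
    have hcomp : (ψ : _ → σ → ℝ) = (freqFrame (gramDA L e dV hdV dW hdW) eW
        (isUnit_archMat_gramDA L e dV hdV hdV0 dW hdW hdW0)) ∘
        (fun w => archMat (Fp L) (Fin (n + n)) (gramDA L e dV hdV dW hdW)⁻¹ *ᵥ w) ∘ D := funext fun az => hψ az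
    rw [hcomp]
    exact ((freqFrame (gramDA L e dV hdV dW hdW) eW
      (isUnit_archMat_gramDA L e dV hdV hdV0 dW hdW hdW0)).bijective.comp (mulVec_bijective_of_isUnit hN)).comp hDb
  refine ⟨LinearEquiv.ofBijective ψ hψb, fun az => ?_⟩
  rw [archPhaseMap_archFolland, archAct_deltaD_diag L e dV hdV hdV0 dW hdW hdW0,
    archFolland_zero _ _ (isUnit_archMat_gramDA L e dV hdV hdV0 dW hdW hdW0), LinearEquiv.ofBijective_apply, hψ, hD]

include hdV0 hdW0 in
/-- **`det d = det A`**: if the archimedean action of `q ∈ Sp(𝕎^𝔻_𝔸)` maps diagonal pairs to diagonal pairs through a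
real-linear `A` (for `q = ι^𝔻(p)`, `p ∈ P_Δ`, it does, through `Res(δ_Δ(p))`), then the `𝕐`-block `d` of `δ q δ⁻¹` at
`∞` in the frame `eW` is `ψ A ψ⁻¹`, so `det d = det A`. [cite: Kudla1994, §3] -/
theorem det_yBlock_eq_det [DecidableEq σ]
    (q : symplecticGroup (polar (adelicForm (Fp L) (Fin (n + n)) (gramDA L e dV hdV dW hdW))))
    (A : ((Fin n → mixedEmbedding.mixedSpace (Fp L)) × (Fin n → mixedEmbedding.mixedSpace (Fp L))) ≃ₗ[ℝ]
      ((Fin n → mixedEmbedding.mixedSpace (Fp L)) × (Fin n → mixedEmbedding.mixedSpace (Fp L))))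
    (hA : ∀ az : (Fin n → mixedEmbedding.mixedSpace (Fp L)) × (Fin n → mixedEmbedding.mixedSpace (Fp L)),
      archAct (gramDA L e dV hdV dW hdW) q
          (Sum.elim az.1 az.1 ∘ ⇑(e₂ (n := n)).symm, Sum.elim az.2 az.2 ∘ ⇑(e₂ (n := n)).symm) =
        (Sum.elim (A az).1 (A az).1 ∘ ⇑(e₂ (n := n)).symm, Sum.elim (A az).2 (A az).2 ∘ ⇑(e₂ (n := n)).symm))
    (d : (σ → ℝ) ≃ₗ[ℝ] (σ → ℝ))
    (hd : ∀ y, d y = (archPhaseMap (gramDA L e dV hdV dW hdW) eW (isUnit_archMat_gramDA L e dV hdV hdV0 dW hdW hdW0)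
      (ratSp (Fp L) (gramDA L e dV hdV dW hdW) (isUnit_det_gramDA L e dV hdV hdV0 dW hdW hdW0) (deltaD L) * q *
        (ratSp (Fp L) (gramDA L e dV hdV dW hdW) (isUnit_det_gramDA L e dV hdV hdV0 dW hdW hdW0) (deltaD L))⁻¹) (0, y)).2) :
    LinearMap.det (d : (σ → ℝ) →ₗ[ℝ] (σ → ℝ)) =
      LinearMap.det (A : ((Fin n → mixedEmbedding.mixedSpace (Fp L)) × (Fin n → mixedEmbedding.mixedSpace (Fp L))) →ₗ[ℝ]
        ((Fin n → mixedEmbedding.mixedSpace (Fp L)) × (Fin n → mixedEmbedding.mixedSpace (Fp L)))) := by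
  obtain ⟨ψ, hψ⟩ := exists_yFrame_diag L e dV hdV hdV0 dW hdW hdW0 eW
  -- `d (ψ az) = ψ (A az)`
  have key : ∀ az : (Fin n → mixedEmbedding.mixedSpace (Fp L)) × (Fin n → mixedEmbedding.mixedSpace (Fp L)),
      d (ψ az) = ψ (A az) := by
    intro az
    have h1 := hψ az
    have h2 := hψ (A az)
    -- `S_δ⁻¹ (0, ψ az) = Ξ (diag az)`
    have h3 : archPhaseMap (gramDA L e dV hdV dW hdW) eW (isUnit_archMat_gramDA L e dV hdV hdV0 dW hdW hdW0)
        (ratSp (Fp L) (gramDA L e dV hdV dW hdW) (isUnit_det_gramDA L e dV hdV hdV0 dW hdW hdW0) (deltaD L))⁻¹ (0, ψ az) =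
        archFolland (gramDA L e dV hdV dW hdW) eW
          (Sum.elim az.1 az.1 ∘ ⇑(e₂ (n := n)).symm, Sum.elim az.2 az.2 ∘ ⇑(e₂ (n := n)).symm) := by
      rw [← h1, ← archPhaseMap_mul, inv_mul_cancel, archPhaseMap_one]
    rw [hd, archPhaseMap_mul, archPhaseMap_mul, h3, archPhaseMap_archFolland, hA az, h2]
  have hconj : (d : (σ → ℝ) →ₗ[ℝ] (σ → ℝ)) =
      ψ.toLinearMap ∘ₗ
        (A : ((Fin n → mixedEmbedding.mixedSpace (Fp L)) × (Fin n → mixedEmbedding.mixedSpace (Fp L))) →ₗ[ℝ]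
          ((Fin n → mixedEmbedding.mixedSpace (Fp L)) × (Fin n → mixedEmbedding.mixedSpace (Fp L)))) ∘ₗ
          ψ.symm.toLinearMap := by
    apply LinearMap.ext
    intro y
    obtain ⟨az, rfl⟩ := ψ.surjective y
    simp only [LinearMap.comp_apply, LinearEquiv.coe_coe, LinearEquiv.symm_apply_apply]
    exact key az
  rw [hconj, LinearMap.det_conj]

end ArchFrame

/-! ### Build-lane note (ops-buildfix G11b-3 recipe, LEDGER B13-1, 2026-08-21)
`lean -o` (the hub build lane, never `lean`/the gate check) runs Lean 4.32's library-suggestion indexers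
(`Lean.LibrarySuggestions.SymbolFrequency` / `SineQuaNon`, from their `exportEntriesFn`) over the statement of
every local theorem that is not a denied premise; on this family's statements (very large dependent binder
telescopes through the theta-kernel / dual-pair data) that fold runs for tens of minutes to hours and the build
lane kills the job (incident G11b-3, run/shared/lean/ops/buildfix/G11b-3-DOSSIER.md). `isDeniedPremise` skips
`[implicit_reducible]` constants before any fold, and a reducibility status on a *theorem* is inert (Meta never
unfolds `thmInfo`; the kernel ignores the attribute), so the public theorems of this file are tagged
`[implicit_reducible]` purely to keep them out of that index. Only other effect: they are not offered by
`+suggestions` premise selectors. No statement or proof is changed; superseded if the operator lands a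
deny-list form (`HarnessLib.PremiseIndex`). -/
set_option allowUnsafeReducibility true in
attribute [implicit_reducible]
  sumElim_comp_sumCongr_e₂_symm' mulVec_comp_equiv_symm' isUnit_det_gramR₀ coe_deltaD'
  isUnit_archMat_gramDA gramDA_eq_reindex gramDA_mulVec_diag coe_mapHom_deltaD
  mapHom_deltaD_mulVec_diag projD_rDelta ratSp_deltaD_apply_diag exists_ratSp_deltaD_apply_diag_eq
  reIm_diag' reIm_symm_diag' mulVec_diag_of_isSiegelDelta toSpD_apply_diag
  conj_deltaD_toSpD_apply_zero_fst archVec_diag piArch_sumElim piArch_mulVec piArch_neg'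
  archAct_deltaD_diag exists_yFrame_diag det_yBlock_eq_det

end Literature.NumberTheory.GelbartRogawski1991.GRConstruction

end
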